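import Literature.MathematicalPhysics.QuantumLattice.ApproximateEigenvectorLemmas
import Literature.MathematicalPhysics.QuantumLattice.QuasiAdiabaticGenerator
import HarnessLib

/-!
# The many-body charge-transport index for an exact symmetry
# (Bachmann–Bols–De Roeck–Fraas, Theorem 2.1 and §4, in the case `UΩ = λΩ`)

S. Bachmann, A. Bols, W. De Roeck, M. Fraas, *A many-body index for quantum charge transport*,
Comm. Math. Phys. **375** (2019) 1249–1272 (BBDF), prove (Theorem 2.1) that for an almost local,
locally charge-conserving unitary `U` and a `U`-invariant state `Ω` with local charge fluctuations
and clustering, the charge `⟨Ω, T₋Ω⟩` transported across one boundary of the half-space `Γ` is an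
integer up to `O(L^{-∞})`; Example 2 / §3.2 (`U` = a lattice translation) is the
Lieb–Schultz–Mattis theorem in every dimension. This file PROVES the theorem in the form needed
for that application — an **exact symmetry**, `UΩ = λΩ` and `U` strictly local, so that BBDF's
Assumptions (i)–(iii) hold with zero error and `K±ᵁ = U⋆K±U` exactly — as a self-contained,
fully quantitative statement about finite matrices
(`exists_int_abs_expect_sub_le_of_exact_symmetry`):

* the state is a unit vector `ψ : n → ℂ`, the symmetry an isometry `T` (`Tᴴ T = 1`, `Tψ = λψ`);
* locality is encoded by two elementwise commuting subalgebras `𝔄₋, 𝔄₊ ≤ Matrix n n ℂ` (the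
  observables near the two boundaries `∂₋`, `∂₊` of `Γ`) and clustering (Assumption (v)) by the
  single numerical hypothesis `|⟨ab⟩ - ⟨a⟩⟨b⟩| ≤ δ‖a‖‖b‖` for `a ∈ 𝔄₋`, `b ∈ 𝔄₊`;
* the dressed charge `Q̄ = Q - K₋ - K₊ = Q̄₋ + Q_m + Q̄₊` (BBDF (4.5)) is given through its three
  Hermitian pieces `Q̄₋ ∈ 𝔄₋`, `Q̄₊ ∈ 𝔄₊`, `Q_m` commuting with `𝔄₋ ∪ 𝔄₊`, and local charge
  fluctuations (Assumption (iv)) by `‖Q̄ψ - qψ‖₂ ≤ ε`; its translate `Q̄ᵀ = TᴴQ̄T = Q̄ᵀ₋ + Q_m + Q̄ᵀ₊`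
  (BBDF (4.6), `Q̄ᵀ₋ = Q₋ + T₋ - K₋ᵀ`) through `Q̄ᵀ₋ ∈ 𝔄₋`, `Q̄ᵀ₊ ∈ 𝔄₊`;
* integrality of the charges enters as `e^{2πiQ_m} = 1` and as the support identity
  `Tᴴ e^{2πiQ̄₋} T = e^{2πiQ̄ᵀ₋}` of BBDF §4.4;
* conclusion: `⟨ψ, (Q̄ᵀ₋ - Q̄₋)ψ⟩` (`= ⟨T₋⟩` in the applications) is within
  `(2π(8πε + δ)‖Q̄ᵀ₋ - Q̄₋‖ + 2√(4πε + 2δ) + 4πε + 2δ)/4` of an integer.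

The proof follows BBDF §4 with the simplifications the exact symmetry allows (no variance of
`U`, no approximants `K±ᵁ`): the symmetry tool (Lemma 4.6) in the sharper form
`|⟨ψ, e^{iφQ̄ᵀ}Me^{-iφQ̄}ψ⟩ - ⟨ψ, Mψ⟩| ≤ 2|φ|ε‖M‖` (`norm_expect_exp_mul_mul_exp_neg_sub_expect_le`)
together with the factorised conjugation identity `e^{iφQ̄ᵀ₋}Ae^{-iφQ̄₋} = e^{iφQ̄ᵀ}(e^{-iφQ̄ᵀ₊}Ae^{iφQ̄₊})e^{-iφQ̄}`
(`exp_mul_mul_exp_neg_eq_conj`); the phase `χ(φ) = ⟨ψ, Z₋(φ)ψ⟩`, `Z₋(φ) = e^{iφQ̄ᵀ₋}e^{-iφQ̄₋}`,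
its derivative (`hasDerivAt_expect_exp_mul_exp_neg`) and the differential inequality
`|χ' - i⟨D⟩χ| ≤ (4|φ|ε + δ)‖D‖`, `D = Q̄ᵀ₋ - Q̄₋` (Lemma 4.5, `norm_chi_deriv_sub_le`; clustering is
used only between `D` and `Z₊(-φ)`, so no variance bound for `Z±(φ)` is needed); §4.4,
`|χ(2π) - 1| ≤ 2√(4πε+2δ) + 4πε + 2δ` (`norm_chi_two_pi_sub_one_le`: `ψ` is an approximate
eigenvector of `e^{2πiQ̄} = e^{2πiQ̄₋}e^{2πiQ̄₊}`, hence, by Lemma 4.2, of `e^{2πiQ̄₋}` and its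
adjoint, and `Z₋(2π) = Tᴴe^{2πiQ̄₋}Te^{-2πiQ̄₋}` acts on `ψ` by `|ρ|² ≈ 1`); and the elementary
lemmas of `ApproximateEigenvectorLemmas.lean` (BBDF §4.1, `dist(x,ℤ) ≤ |e^{2πix}-1|/4`, the
comparison lemma for `χ' = iaχ + O(E)`).

This is the abstract half of the proof of the named fact `bbdf2019_lsm_filling_hubbardTorus`
(`HubbardLSMFilling.lean`); the model-specific half (BBDF Prop. 2.4 for the Hubbard torus:
`ε = O(L^{-∞})` from the quasi-adiabatic dressing `K± = i𝓘(J±)` and Lieb–Robinson bounds,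
`δ = O(e^{-cL})` from exponential clustering, and `⟨D⟩ = -N_σ/L` for the translation) is separate.
Theorems only; no definition and no named fact is introduced.

## References

* S. Bachmann, A. Bols, W. De Roeck, M. Fraas, Comm. Math. Phys. **375** (2019) 1249–1272,
  arXiv:1810.07351: Theorem 2.1, §4.2 (eqs. (4.5)–(4.8)), Lemma 4.5, Lemma 4.6, §4.4; §3.2.
  [BachmannEtAl2019]
* Mathlib: `Matrix.exp_add_of_commute`, `Matrix.exp_conjTranspose`, `Commute.exp_left/right`,
  `hasDerivAt_exp_smul_const(')`, `HasDerivAt.mul`, `Matrix.l2_opNorm_mul`, `Matrix.cstar_norm_def`,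
  `Matrix.IsHermitian.im_star_dotProduct_mulVec_self`; the tree: `ApproximateEigenvectorLemmas`
  (`eucNorm`, BBDF §4.1), `QuasiAdiabaticGenerator` (`matrixElementCLM`, `exp_mem_of_mem_subalgebra`),
  `LocalDynamics` (`exp_smul_mul_exp_neg_smul`), `LiebRobinsonIntegralProofs` (`hasDerivAt_exp_smul_left/right`,
  `exp_I_mul_smul`), `LiebRobinsonHastingsKomaSpectralProofs` (`conjTranspose_exp_I_mul_smul`).
-/

noncomputable section

open Matrix Complex Finset
open scoped Matrix.Norms.L2Operator ComplexOrder InnerProductSpace Real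

namespace Literature.MathematicalPhysics.QuantumLattice

variable {n : Type*} [Fintype n] [DecidableEq n]

/-! ### Unitary one-parameter groups `e^{iφX}` of Hermitian matrices -/

section ExpUnitary

/-- `e^{iφX}` is an isometry: `(e^{iφX})ᴴ e^{iφX} = 1`. [folklore] -/
theorem conjTranspose_exp_I_mul_smul_mul_self {X : Matrix n n ℂ} (hX : X.IsHermitian) (φ : ℝ) :
    (NormedSpace.exp ((I * (φ : ℂ)) • X))ᴴ * NormedSpace.exp ((I * (φ : ℂ)) • X) = 1 := by
  rw [conjTranspose_exp_I_mul_smul hX, exp_neg_smul_mul_exp_smul]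

/-- `e^{iφX} (e^{iφX})ᴴ = 1`. [folklore] -/
theorem exp_I_mul_smul_mul_conjTranspose_self {X : Matrix n n ℂ} (hX : X.IsHermitian) (φ : ℝ) :
    NormedSpace.exp ((I * (φ : ℂ)) • X) * (NormedSpace.exp ((I * (φ : ℂ)) • X))ᴴ = 1 := by
  rw [conjTranspose_exp_I_mul_smul hX, exp_smul_mul_exp_neg_smul]

/-- `‖e^{iφX} v‖₂ = ‖v‖₂`. [folklore] -/
theorem eucNorm_exp_I_mul_smul_mulVec {X : Matrix n n ℂ} (hX : X.IsHermitian) (φ : ℝ) (v : n → ℂ) :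
    eucNorm (NormedSpace.exp ((I * (φ : ℂ)) • X) *ᵥ v) = eucNorm v :=
  eucNorm_mulVec_of_conjTranspose_mul_self (conjTranspose_exp_I_mul_smul_mul_self hX φ) v

/-- `‖e^{-iφX} v‖₂ = ‖v‖₂` (the form with the negated exponent). [folklore] -/
theorem eucNorm_exp_neg_I_mul_smul_mulVec {X : Matrix n n ℂ} (hX : X.IsHermitian) (φ : ℝ) (v : n → ℂ) :
    eucNorm (NormedSpace.exp ((-(I * (φ : ℂ))) • X) *ᵥ v) = eucNorm v := by
  have h := eucNorm_exp_I_mul_smul_mulVec hX (-φ) v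
  rwa [show (I * ((-φ : ℝ) : ℂ)) = -(I * (φ : ℂ)) by push_cast; ring] at h

/-- An isometry has `L²`-operator norm at most one. [folklore] -/
theorem norm_le_one_of_conjTranspose_mul_self {W : Matrix n n ℂ} (hW : Wᴴ * W = 1) : ‖W‖ ≤ 1 := by
  rw [cstar_norm_def]
  refine ContinuousLinearMap.opNorm_le_bound _ zero_le_one fun x => ?_
  have h := eucNorm_mulVec_of_conjTranspose_mul_self hW (WithLp.ofLp x)
  have hx : eucNorm (WithLp.ofLp x) = ‖x‖ := rfl
  have hWx : eucNorm (W *ᵥ WithLp.ofLp x) = ‖toEuclideanCLM (n := n) (𝕜 := ℂ) W x‖ := rfl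
  rw [one_mul, ← hx, ← hWx, h]

/-- `‖U A V‖ ≤ ‖A‖` for isometries `U`, `V`. [folklore] -/
theorem norm_isometry_mul_mul_isometry_le {U A V : Matrix n n ℂ} (hU : Uᴴ * U = 1) (hV : Vᴴ * V = 1) :
    ‖U * A * V‖ ≤ ‖A‖ := by
  calc ‖U * A * V‖ ≤ ‖U * A‖ * ‖V‖ := Matrix.l2_opNorm_mul _ _
    _ ≤ ‖U‖ * ‖A‖ * ‖V‖ := mul_le_mul_of_nonneg_right (Matrix.l2_opNorm_mul _ _) (norm_nonneg _)
    _ ≤ 1 * ‖A‖ * 1 := by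
        gcongr
        · exact norm_le_one_of_conjTranspose_mul_self hU
        · exact norm_le_one_of_conjTranspose_mul_self hV
    _ = ‖A‖ := by ring

/-- Exponentials of commuting matrices commute (any scalar multiples). [folklore] -/
theorem commute_exp_smul_exp_smul {X Y : Matrix n n ℂ} (h : Commute X Y) (a b : ℂ) :
    Commute (NormedSpace.exp (a • X)) (NormedSpace.exp (b • Y)) :=
  ((h.smul_left a).smul_right b).exp_left.exp_right

/-- A matrix commuting with `X` commutes with `e^{aX}`. [folklore] -/
theorem commute_exp_smul_of_commute {X A : Matrix n n ℂ} (h : Commute X A) (a : ℂ) :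
    Commute (NormedSpace.exp (a • X)) A :=
  (h.smul_left a).exp_left

/-- `e^{aX} A e^{-aX} = A` when `X` commutes with `A`. [folklore] -/
theorem exp_smul_mul_mul_exp_neg_smul_of_commute {X A : Matrix n n ℂ} (h : Commute X A) (a : ℂ) :
    NormedSpace.exp (a • X) * A * NormedSpace.exp ((-a) • X) = A := by
  rw [(commute_exp_smul_of_commute h a).eq, mul_assoc, exp_smul_mul_exp_neg_smul, mul_one]

/-- The exponential of a sum of three pairwise commuting matrices. [folklore] -/
theorem exp_add_add_of_commute {A B C : Matrix n n ℂ} (hAB : Commute A B) (hAC : Commute A C)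
    (hBC : Commute B C) :
    NormedSpace.exp (A + B + C) = NormedSpace.exp A * NormedSpace.exp B * NormedSpace.exp C := by
  rw [Matrix.exp_add_of_commute (A + B) C (hAC.add_left hBC), Matrix.exp_add_of_commute A B hAB]

/-- `e^{a(X+Y+Z)} = e^{aX} e^{aY} e^{aZ}` for pairwise commuting `X, Y, Z`. [folklore] -/
theorem exp_smul_add_add_of_commute {X Y Z : Matrix n n ℂ} (hXY : Commute X Y) (hXZ : Commute X Z)
    (hYZ : Commute Y Z) (a : ℂ) :
    NormedSpace.exp (a • (X + Y + Z)) =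
      NormedSpace.exp (a • X) * NormedSpace.exp (a • Y) * NormedSpace.exp (a • Z) := by
  rw [smul_add, smul_add]
  exact exp_add_add_of_commute ((hXY.smul_left a).smul_right a) ((hXZ.smul_left a).smul_right a)
    ((hYZ.smul_left a).smul_right a)

omit [DecidableEq n] in
/-- The expectation of a Hermitian matrix in any vector is real. [folklore] -/
theorem expect_eq_re_of_isHermitian {D : Matrix n n ℂ} (hD : D.IsHermitian) (ψ : n → ℂ) :
    star ψ ⬝ᵥ (D *ᵥ ψ) = ((star ψ ⬝ᵥ (D *ᵥ ψ)).re : ℂ) := by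
  refine Complex.ext rfl ?_
  rw [Complex.ofReal_im]
  exact hD.im_star_dotProduct_mulVec_self ψ

omit [DecidableEq n] in
/-- `⟨ψ, U w⟩ = ⟨Uᴴ ψ, w⟩`. [folklore] -/
theorem star_dotProduct_mulVec_eq_star_conjTranspose_mulVec_dotProduct (U : Matrix n n ℂ) (ψ w : n → ℂ) :
    star ψ ⬝ᵥ (U *ᵥ w) = star (Uᴴ *ᵥ ψ) ⬝ᵥ w := by
  rw [star_mulVec, conjTranspose_conjTranspose, dotProduct_mulVec]

end ExpUnitary

/-! ### Symmetric states: a unit vector which is an eigenvector of an isometry -/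

section Symmetry

/-- If `Tᴴ T = 1`, `ψ` is a unit vector and `T ψ = λ ψ`, then `|λ| = 1`. [folklore] -/
theorem norm_eq_one_of_isometry_eigen {T : Matrix n n ℂ} (hT : Tᴴ * T = 1) {ψ : n → ℂ}
    (hψ1 : star ψ ⬝ᵥ ψ = 1) {lam : ℂ} (hTψ : T *ᵥ ψ = lam • ψ) : ‖lam‖ = 1 := by
  have h := eucNorm_mulVec_of_conjTranspose_mul_self hT ψ
  rwa [hTψ, eucNorm_smul, eucNorm_eq_one hψ1, mul_one] at h

/-- If `Tᴴ T = 1` and `T ψ = λ ψ` with `λ ≠ 0`, then `Tᴴ ψ = λ⁻¹ ψ`. [folklore] -/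
theorem conjTranspose_mulVec_of_isometry_eigen {T : Matrix n n ℂ} (hT : Tᴴ * T = 1) {ψ : n → ℂ}
    {lam : ℂ} (hTψ : T *ᵥ ψ = lam • ψ) (hlam : lam ≠ 0) : Tᴴ *ᵥ ψ = lam⁻¹ • ψ := by
  have h : Tᴴ *ᵥ (T *ᵥ ψ) = ψ := by rw [mulVec_mulVec, hT, one_mulVec]
  rw [hTψ, mulVec_smul] at h
  have h2 := congrArg (fun v => lam⁻¹ • v) h
  simp only [smul_smul, inv_mul_cancel₀ hlam, one_smul] at h2
  exact h2

/-- **An approximate eigenvector is transported by a symmetry of the state**: if `Tᴴ T = 1` and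
`T ψ = λ ψ` (`ψ ≠ 0`), then `‖(Tᴴ Q T) ψ - q ψ‖₂ = ‖Q ψ - q ψ‖₂`. [folklore] -/
theorem eucNorm_conjTranspose_mul_mul_mulVec_sub_smul {T Q : Matrix n n ℂ} (hT : Tᴴ * T = 1)
    {ψ : n → ℂ} (hψ1 : star ψ ⬝ᵥ ψ = 1) {lam : ℂ} (hTψ : T *ᵥ ψ = lam • ψ) (q : ℂ) :
    eucNorm ((Tᴴ * Q * T) *ᵥ ψ - q • ψ) = eucNorm (Q *ᵥ ψ - q • ψ) := by
  have hlam : ‖lam‖ = 1 := norm_eq_one_of_isometry_eigen hT hψ1 hTψ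
  have hTT : T * Tᴴ = 1 := mul_eq_one_comm.1 hT
  have h : Tᴴ *ᵥ (T *ᵥ ψ) = ψ := by rw [mulVec_mulVec, hT, one_mulVec]
  rw [hTψ, mulVec_smul] at h
  -- `q ψ = λ Tᴴ (q ψ)`
  have h2 : q • ψ = lam • (Tᴴ *ᵥ (q • ψ)) := by
    conv_lhs => rw [← h]
    rw [mulVec_smul, smul_comm]
  have hL : (Tᴴ * Q * T) *ᵥ ψ = lam • (Tᴴ *ᵥ (Q *ᵥ ψ)) := by
    rw [← mulVec_mulVec, ← mulVec_mulVec, hTψ, mulVec_smul, mulVec_smul]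
  have key : (Tᴴ * Q * T) *ᵥ ψ - q • ψ = lam • (Tᴴ *ᵥ (Q *ᵥ ψ - q • ψ)) := by
    rw [hL, mulVec_sub, smul_sub, ← h2]
  rw [key, eucNorm_smul, hlam, one_mul]
  have hTH : (Tᴴ)ᴴ * Tᴴ = 1 := by rw [conjTranspose_conjTranspose, hTT]
  exact eucNorm_mulVec_of_conjTranspose_mul_self hTH _

end Symmetry

/-! ### The symmetry tool (BBDF Lemma 4.6, exact-symmetry form) -/

section SymmetryTool

omit [DecidableEq n] in
/-- `|u⋆ · (M v)| ≤ ‖u‖₂ ‖M‖ ‖v‖₂`. [folklore] -/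
theorem norm_star_dotProduct_mulVec_le_eucNorm [DecidableEq n] (M : Matrix n n ℂ) (u v : n → ℂ) :
    ‖star u ⬝ᵥ (M *ᵥ v)‖ ≤ eucNorm u * ‖M‖ * eucNorm v := by
  calc ‖star u ⬝ᵥ (M *ᵥ v)‖ ≤ eucNorm u * eucNorm (M *ᵥ v) := norm_star_dotProduct_le u _
    _ ≤ eucNorm u * (‖M‖ * eucNorm v) :=
        mul_le_mul_of_nonneg_left (eucNorm_mulVec_le M v) (eucNorm_nonneg u)
    _ = eucNorm u * ‖M‖ * eucNorm v := by ring

/-- **BBDF Lemma 4.3 at `-φ`**: `‖e^{-iφX}ψ - e^{-iφq}ψ‖₂ ≤ |φ| ‖(X - q)ψ‖₂`.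
[cite: BachmannEtAl2019, Lemma 4.3] -/
theorem eucNorm_exp_neg_mulVec_sub_le {X : Matrix n n ℂ} (hX : X.IsHermitian) (ψ : n → ℂ) (q φ : ℝ) :
    eucNorm (NormedSpace.exp ((-(I * (φ : ℂ))) • X) *ᵥ ψ - cexp (-(I * φ * q)) • ψ) ≤
      |φ| * eucNorm (X *ᵥ ψ - (q : ℂ) • ψ) := by
  have h := eucNorm_exp_mulVec_sub_le hX ψ q (-φ)
  rw [abs_neg] at h
  convert h using 3 <;> push_cast <;> ring_nf

/-- **The symmetry tool (BBDF Lemma 4.6, for an exact symmetry).** If `ψ` is a unit vector which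
is an `ε`-approximate eigenvector, with the same approximate eigenvalue `q`, of the Hermitian
matrices `Q̄` and `Q̄ᵀ`, then for every `M` and real `φ`,
`|⟨ψ, e^{iφQ̄ᵀ} M e^{-iφQ̄} ψ⟩ - ⟨ψ, M ψ⟩| ≤ 2|φ| ε ‖M‖`: the two phases `e^{±iφq}` cancel.
(BBDF apply this with `M = e^{-iφQ̄ᵀ₊} A e^{iφQ̄₊}` after the factorisation
`e^{iφQ̄ᵀ₋} A e^{-iφQ̄₋} = e^{iφQ̄ᵀ} M e^{-iφQ̄}`, `exp_mul_mul_exp_neg_eq_conj` below.)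
[cite: BachmannEtAl2019, Lemma 4.6 (proof)] -/
theorem norm_expect_exp_mul_mul_exp_neg_sub_expect_le {Qb QbT M : Matrix n n ℂ}
    (hQb : Qb.IsHermitian) (hQbT : QbT.IsHermitian) {ψ : n → ℂ} (hψ1 : star ψ ⬝ᵥ ψ = 1)
    {q ε : ℝ} (hε : eucNorm (Qb *ᵥ ψ - (q : ℂ) • ψ) ≤ ε) (hεT : eucNorm (QbT *ᵥ ψ - (q : ℂ) • ψ) ≤ ε)
    (φ : ℝ) :
    ‖star ψ ⬝ᵥ ((NormedSpace.exp ((I * (φ : ℂ)) • QbT) * M * NormedSpace.exp ((-(I * (φ : ℂ))) • Qb)) *ᵥ ψ) -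
        star ψ ⬝ᵥ (M *ᵥ ψ)‖ ≤ 2 * |φ| * ε * ‖M‖ := by
  set U₁ := NormedSpace.exp ((I * (φ : ℂ)) • QbT) with hU₁
  set U₂ := NormedSpace.exp ((-(I * (φ : ℂ))) • Qb) with hU₂
  set c : ℂ := cexp (-(I * φ * q)) with hc
  -- the two remainders
  set r₁ := U₂ *ᵥ ψ - c • ψ with hr₁
  set r₂ := U₁ᴴ *ᵥ ψ - c • ψ with hr₂
  have hr₁_le : eucNorm r₁ ≤ |φ| * ε :=
    (eucNorm_exp_neg_mulVec_sub_le hQb ψ q φ).trans (mul_le_mul_of_nonneg_left hε (abs_nonneg φ))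
  have hr₂_le : eucNorm r₂ ≤ |φ| * ε := by
    have hU₁H : U₁ᴴ = NormedSpace.exp ((-(I * (φ : ℂ))) • QbT) := conjTranspose_exp_I_mul_smul hQbT φ
    rw [hr₂, hU₁H]
    exact (eucNorm_exp_neg_mulVec_sub_le hQbT ψ q φ).trans (mul_le_mul_of_nonneg_left hεT (abs_nonneg φ))
  have hcn : ‖c‖ = 1 := by
    have e : (-(I * φ * q) : ℂ) = ((-(φ * q) : ℝ) : ℂ) * I := by push_cast; ring
    rw [hc, e, Complex.norm_exp_ofReal_mul_I]
  have hcc : starRingEnd ℂ c * c = 1 := by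
    rw [Complex.conj_mul', hcn]; simp
  have hψn : eucNorm ψ = 1 := eucNorm_eq_one hψ1
  -- expansion of the matrix element
  have hU₂ψ : U₂ *ᵥ ψ = c • ψ + r₁ := by rw [hr₁]; abel
  have hU₁ψ : U₁ᴴ *ᵥ ψ = c • ψ + r₂ := by rw [hr₂]; abel
  have hexp : star ψ ⬝ᵥ ((U₁ * M * U₂) *ᵥ ψ) =
      star ψ ⬝ᵥ (M *ᵥ ψ) + starRingEnd ℂ c * (star ψ ⬝ᵥ (M *ᵥ r₁)) + star r₂ ⬝ᵥ (M *ᵥ (U₂ *ᵥ ψ)) := by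
    have e1 : star ψ ⬝ᵥ ((U₁ * M * U₂) *ᵥ ψ) = star (U₁ᴴ *ᵥ ψ) ⬝ᵥ (M *ᵥ (U₂ *ᵥ ψ)) := by
      rw [Matrix.mul_assoc, ← mulVec_mulVec, star_dotProduct_mulVec_eq_star_conjTranspose_mulVec_dotProduct,
        ← mulVec_mulVec]
    have aux : star ψ ⬝ᵥ (M *ᵥ (U₂ *ᵥ ψ)) = c * (star ψ ⬝ᵥ (M *ᵥ ψ)) + star ψ ⬝ᵥ (M *ᵥ r₁) := by
      rw [hU₂ψ, mulVec_add, mulVec_smul, dotProduct_add, dotProduct_smul, smul_eq_mul]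
    rw [e1, hU₁ψ, star_add, add_dotProduct, star_smul, smul_dotProduct, aux, smul_eq_mul,
      Complex.star_def, mul_add, ← mul_assoc, hcc, one_mul]
  rw [hexp, add_assoc, add_sub_cancel_left]
  -- bounds
  have hb1 : ‖starRingEnd ℂ c * (star ψ ⬝ᵥ (M *ᵥ r₁))‖ ≤ |φ| * ε * ‖M‖ := by
    rw [norm_mul, Complex.norm_conj, hcn, one_mul]
    calc ‖star ψ ⬝ᵥ (M *ᵥ r₁)‖ ≤ eucNorm ψ * ‖M‖ * eucNorm r₁ := norm_star_dotProduct_mulVec_le_eucNorm M ψ r₁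
      _ ≤ 1 * ‖M‖ * (|φ| * ε) := by
          rw [hψn]; exact mul_le_mul_of_nonneg_left hr₁_le (by positivity)
      _ = |φ| * ε * ‖M‖ := by ring
  have hb2 : ‖star r₂ ⬝ᵥ (M *ᵥ (U₂ *ᵥ ψ))‖ ≤ |φ| * ε * ‖M‖ := by
    calc ‖star r₂ ⬝ᵥ (M *ᵥ (U₂ *ᵥ ψ))‖ ≤ eucNorm r₂ * ‖M‖ * eucNorm (U₂ *ᵥ ψ) :=
          norm_star_dotProduct_mulVec_le_eucNorm M r₂ _
      _ = eucNorm r₂ * ‖M‖ := by rw [hU₂, eucNorm_exp_neg_I_mul_smul_mulVec hQb, hψn, mul_one]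
      _ ≤ |φ| * ε * ‖M‖ := mul_le_mul_of_nonneg_right hr₂_le (norm_nonneg _)
  calc ‖starRingEnd ℂ c * (star ψ ⬝ᵥ (M *ᵥ r₁)) + star r₂ ⬝ᵥ (M *ᵥ (U₂ *ᵥ ψ))‖
      ≤ |φ| * ε * ‖M‖ + |φ| * ε * ‖M‖ := norm_add_le_of_le hb1 hb2
    _ = 2 * |φ| * ε * ‖M‖ := by ring

end SymmetryTool

/-! ### The factorised conjugation identity and the derivative of `χ` -/

section Factorisation

/-- **The factorised conjugation identity (BBDF, proof of Lemma 4.6).** Let `Q̄ = Q̄₋ + Q_m + Q̄₊`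
and `Q̄ᵀ = Q̄ᵀ₋ + Q_m + Q̄ᵀ₊` with `Q_m` commuting with `Q̄₋, Q̄₊, Q̄ᵀ₋, Q̄ᵀ₊` and with `A`,
`Q̄₋` commuting with `Q̄₊`, and `Q̄ᵀ₋` commuting with `Q̄ᵀ₊`. Then
`e^{aQ̄ᵀ₋} A e^{-aQ̄₋} = e^{aQ̄ᵀ} (e^{-aQ̄ᵀ₊} A e^{aQ̄₊}) e^{-aQ̄}`.
[cite: BachmannEtAl2019, Lemma 4.6 (proof)] -/
theorem exp_mul_mul_exp_neg_eq_conj {Qm QmT Qp QpT Qmid A : Matrix n n ℂ}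
    (hc_m_mid : Commute Qm Qmid) (hc_m_p : Commute Qm Qp) (hc_mid_p : Commute Qmid Qp)
    (hc_mT_mid : Commute QmT Qmid) (hc_mT_pT : Commute QmT QpT) (hc_mid_pT : Commute Qmid QpT)
    (hA : Commute Qmid A) (a : ℂ) :
    NormedSpace.exp (a • QmT) * A * NormedSpace.exp ((-a) • Qm) =
      NormedSpace.exp (a • (QmT + Qmid + QpT)) *
        (NormedSpace.exp ((-a) • QpT) * A * NormedSpace.exp (a • Qp)) *
        NormedSpace.exp ((-a) • (Qm + Qmid + Qp)) := by
  rw [exp_smul_add_add_of_commute hc_mT_mid hc_mT_pT hc_mid_pT a,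
    exp_smul_add_add_of_commute hc_m_mid hc_m_p hc_mid_p (-a)]
  set ET1 := NormedSpace.exp (a • QmT)
  set ET2 := NormedSpace.exp (a • Qmid)
  set ET3 := NormedSpace.exp (a • QpT)
  set F1 := NormedSpace.exp ((-a) • Qm)
  set F2 := NormedSpace.exp ((-a) • Qmid)
  set F3 := NormedSpace.exp ((-a) • Qp)
  set G := NormedSpace.exp ((-a) • QpT)
  set P := NormedSpace.exp (a • Qp)
  have h3 : ET3 * G = 1 := exp_smul_mul_exp_neg_smul QpT a
  have h4 : P * F1 = F1 * P := (commute_exp_smul_exp_smul hc_m_p.symm a (-a)).eq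
  have h5 : P * F2 = F2 * P := (commute_exp_smul_exp_smul hc_mid_p.symm a (-a)).eq
  have h6 : P * F3 = 1 := exp_smul_mul_exp_neg_smul Qp a
  have h7 : ET2 * A = A * ET2 := (commute_exp_smul_of_commute hA a).eq
  have h8 : ET2 * F1 = F1 * ET2 := (commute_exp_smul_exp_smul hc_m_mid.symm a (-a)).eq
  have h9 : ET2 * F2 = 1 := exp_smul_mul_exp_neg_smul Qmid a
  symm
  calc ET1 * ET2 * ET3 * (G * A * P) * (F1 * F2 * F3)
      = ET1 * ET2 * (ET3 * G) * A * (P * F1) * F2 * F3 := by simp only [Matrix.mul_assoc]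
    _ = ET1 * ET2 * A * F1 * (P * F2) * F3 := by rw [h3, Matrix.mul_one, h4]; simp only [Matrix.mul_assoc]
    _ = ET1 * ET2 * A * F1 * F2 * (P * F3) := by rw [h5]; simp only [Matrix.mul_assoc]
    _ = ET1 * (ET2 * A) * F1 * F2 := by rw [h6, Matrix.mul_one]; simp only [Matrix.mul_assoc]
    _ = ET1 * A * (ET2 * F1) * F2 := by rw [h7]; simp only [Matrix.mul_assoc]
    _ = ET1 * A * F1 * (ET2 * F2) := by rw [h8]; simp only [Matrix.mul_assoc]
    _ = ET1 * A * F1 := by rw [h9, Matrix.mul_one]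

/-- A matrix commuting with `X` can be pulled out of a conjugation: `e^{aX} A B = A (e^{aX} B)`,
in the form `e^{aX} A B = A e^{aX} B`. [folklore] -/
theorem exp_smul_mul_mul_of_commute {X A : Matrix n n ℂ} (h : Commute X A) (a : ℂ) (B : Matrix n n ℂ) :
    NormedSpace.exp (a • X) * A * B = A * (NormedSpace.exp (a • X) * B) := by
  rw [(commute_exp_smul_of_commute h a).eq, Matrix.mul_assoc]

/-- **The derivative of `χ(φ) = ⟨ψ, e^{iφQ̄ᵀ₋} e^{-iφQ̄₋} ψ⟩`**:
`χ'(φ) = i ⟨ψ, e^{iφQ̄ᵀ₋} (Q̄ᵀ₋ - Q̄₋) e^{-iφQ̄₋} ψ⟩`. [cite: BachmannEtAl2019, proof of Lemma 4.5] -/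
theorem hasDerivAt_expect_exp_mul_exp_neg (QmT Qm : Matrix n n ℂ) (ψ : n → ℂ) (φ : ℝ) :
    HasDerivAt (fun u : ℝ => star ψ ⬝ᵥ ((NormedSpace.exp ((I * (u : ℂ)) • QmT) *
        NormedSpace.exp ((-(I * (u : ℂ))) • Qm)) *ᵥ ψ))
      (I * (star ψ ⬝ᵥ ((NormedSpace.exp ((I * (φ : ℂ)) • QmT) * (QmT - Qm) *
        NormedSpace.exp ((-(I * (φ : ℂ))) • Qm)) *ᵥ ψ))) φ := by
  set K₁ : Matrix n n ℂ := (I : ℂ) • QmT with hK₁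
  set K₂ : Matrix n n ℂ := -((I : ℂ) • Qm) with hK₂
  have hfun : (fun u : ℝ => star ψ ⬝ᵥ ((NormedSpace.exp ((I * (u : ℂ)) • QmT) *
        NormedSpace.exp ((-(I * (u : ℂ))) • Qm)) *ᵥ ψ)) =
      fun u : ℝ => matrixElementCLM ψ ψ (NormedSpace.exp ((u : ℝ) • K₁) * NormedSpace.exp ((u : ℝ) • K₂)) := by
    funext u
    rw [matrixElementCLM_apply, exp_I_mul_smul, exp_neg_I_mul_smul]
  have hd : HasDerivAt (fun u : ℝ => NormedSpace.exp ((u : ℝ) • K₁) * NormedSpace.exp ((u : ℝ) • K₂))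
      (K₁ * NormedSpace.exp ((φ : ℝ) • K₁) * NormedSpace.exp ((φ : ℝ) • K₂) +
        NormedSpace.exp ((φ : ℝ) • K₁) * (NormedSpace.exp ((φ : ℝ) • K₂) * K₂)) φ :=
    (hasDerivAt_exp_smul_left K₁ φ).mul (hasDerivAt_exp_smul_right K₂ φ)
  have hderiv_eq : K₁ * NormedSpace.exp ((φ : ℝ) • K₁) * NormedSpace.exp ((φ : ℝ) • K₂) +
        NormedSpace.exp ((φ : ℝ) • K₁) * (NormedSpace.exp ((φ : ℝ) • K₂) * K₂) =
      (I : ℂ) • (NormedSpace.exp ((I * (φ : ℂ)) • QmT) * (QmT - Qm) *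
        NormedSpace.exp ((-(I * (φ : ℂ))) • Qm)) := by
    have hc1 : K₁ * NormedSpace.exp ((φ : ℝ) • K₁) = NormedSpace.exp ((φ : ℝ) • K₁) * K₁ :=
      (((Commute.refl K₁).smul_right (φ : ℝ)).exp_right).eq
    have hc2 : NormedSpace.exp ((φ : ℝ) • K₂) * K₂ = K₂ * NormedSpace.exp ((φ : ℝ) • K₂) :=
      (((Commute.refl K₂).smul_right (φ : ℝ)).exp_right).eq.symm
    rw [hc1, hc2, ← exp_I_mul_smul, ← exp_neg_I_mul_smul, Matrix.mul_assoc, ← Matrix.mul_add,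
      ← Matrix.add_mul, hK₁, hK₂, ← sub_eq_add_neg, ← smul_sub, Matrix.smul_mul, Matrix.mul_smul,
      Matrix.mul_assoc]
  have h := ((matrixElementCLM ψ ψ).restrictScalars ℝ).hasFDerivAt.comp_hasDerivAt φ hd
  rw [hfun]
  refine h.congr_deriv ?_
  rw [ContinuousLinearMap.coe_restrictScalars', hderiv_eq, map_smul, smul_eq_mul, matrixElementCLM_apply]

end Factorisation

/-! ### The differential inequality `χ' = i⟨D⟩χ + O(ε, δ)` (BBDF Lemma 4.5) -/

section OdeEstimate

omit [DecidableEq n] in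
/-- `|⟨ψ, D ψ⟩| ≤ ‖D‖` for a unit vector `ψ`. [folklore] -/
theorem norm_expect_le_norm [DecidableEq n] {ψ : n → ℂ} (hψ1 : star ψ ⬝ᵥ ψ = 1) (D : Matrix n n ℂ) :
    ‖star ψ ⬝ᵥ (D *ᵥ ψ)‖ ≤ ‖D‖ := by
  refine (norm_star_dotProduct_le_eucNorm hψ1 _).trans ?_
  have h := eucNorm_mulVec_le D ψ
  rwa [eucNorm_eq_one hψ1, mul_one] at h

/-- **BBDF Lemma 4.5, the differential inequality (exact-symmetry form).** With
`χ(φ) = ⟨ψ, e^{iφQ̄ᵀ₋} e^{-iφQ̄₋} ψ⟩`, `D = Q̄ᵀ₋ - Q̄₋` and `χ'(φ) = i⟨ψ, e^{iφQ̄ᵀ₋} D e^{-iφQ̄₋} ψ⟩`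
(`hasDerivAt_expect_exp_mul_exp_neg`): if `ψ` is a unit vector which is an `ε`-approximate
eigenvector of `Q̄ = Q̄₋ + Q_m + Q̄₊` and of `Q̄ᵀ = Q̄ᵀ₋ + Q_m + Q̄ᵀ₊` (same approximate eigenvalue),
the pieces commute as indicated, and the state clusters between `D` and
`Z₊(-φ) = e^{-iφQ̄ᵀ₊} e^{iφQ̄₊}` up to `δ‖D‖`, then `|χ'(φ) - i⟨ψ, Dψ⟩ χ(φ)| ≤ (4|φ|ε + δ)‖D‖`.
The proof is BBDF's: the symmetry tool (`norm_expect_exp_mul_mul_exp_neg_sub_expect_le`) moves the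
conjugation from the `-` pieces to the `+` pieces, where `D` factors out and clustering applies.
[cite: BachmannEtAl2019, Lemma 4.5 (proof) and Lemma 4.6] -/
theorem norm_chi_deriv_sub_le {Qm QmT Qp QpT Qmid : Matrix n n ℂ}
    (hQm : Qm.IsHermitian) (hQmT : QmT.IsHermitian) (hQp : Qp.IsHermitian) (hQpT : QpT.IsHermitian)
    (hQmid : Qmid.IsHermitian)
    (hc_m_mid : Commute Qm Qmid) (hc_m_p : Commute Qm Qp) (hc_mid_p : Commute Qmid Qp)
    (hc_mT_mid : Commute QmT Qmid) (hc_mT_pT : Commute QmT QpT) (hc_mid_pT : Commute Qmid QpT)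
    (hc_m_pT : Commute Qm QpT)
    {ψ : n → ℂ} (hψ1 : star ψ ⬝ᵥ ψ = 1) {q ε δ : ℝ} (hε : 0 ≤ ε)
    (hQ : eucNorm ((Qm + Qmid + Qp) *ᵥ ψ - (q : ℂ) • ψ) ≤ ε)
    (hQT : eucNorm ((QmT + Qmid + QpT) *ᵥ ψ - (q : ℂ) • ψ) ≤ ε) (φ : ℝ)
    (hclD : ‖star ψ ⬝ᵥ (((QmT - Qm) * (NormedSpace.exp ((-(I * (φ : ℂ))) • QpT) *
          NormedSpace.exp ((I * (φ : ℂ)) • Qp))) *ᵥ ψ) -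
        (star ψ ⬝ᵥ ((QmT - Qm) *ᵥ ψ)) *
          (star ψ ⬝ᵥ ((NormedSpace.exp ((-(I * (φ : ℂ))) • QpT) *
            NormedSpace.exp ((I * (φ : ℂ)) • Qp)) *ᵥ ψ))‖ ≤ δ * ‖QmT - Qm‖) :
    ‖I * (star ψ ⬝ᵥ ((NormedSpace.exp ((I * (φ : ℂ)) • QmT) * (QmT - Qm) *
          NormedSpace.exp ((-(I * (φ : ℂ))) • Qm)) *ᵥ ψ)) -
      I * (star ψ ⬝ᵥ ((QmT - Qm) *ᵥ ψ)) *
        (star ψ ⬝ᵥ ((NormedSpace.exp ((I * (φ : ℂ)) • QmT) *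
          NormedSpace.exp ((-(I * (φ : ℂ))) • Qm)) *ᵥ ψ))‖ ≤
      (4 * |φ| * ε + δ) * ‖QmT - Qm‖ := by
  set a : ℂ := I * (φ : ℂ) with ha
  set D := QmT - Qm with hD
  set U := NormedSpace.exp (a • QmT) with hU
  set V := NormedSpace.exp ((-a) • Qm) with hV
  set Wp := NormedSpace.exp ((-a) • QpT) with hWp
  set Xp := NormedSpace.exp (a • Qp) with hXp
  -- Hermitian sums
  have hQbar : (Qm + Qmid + Qp).IsHermitian := (hQm.add hQmid).add hQp
  have hQbarT : (QmT + Qmid + QpT).IsHermitian := (hQmT.add hQmid).add hQpT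
  -- commutation of `Q_m` with `D` and `1`
  have hmidD : Commute Qmid D := hc_mT_mid.symm.sub_right hc_m_mid.symm
  have hmid1 : Commute Qmid (1 : Matrix n n ℂ) := Commute.one_right _
  -- the factorised identities
  have hfacD : U * D * V = NormedSpace.exp (a • (QmT + Qmid + QpT)) * (Wp * D * Xp) *
      NormedSpace.exp ((-a) • (Qm + Qmid + Qp)) :=
    exp_mul_mul_exp_neg_eq_conj hc_m_mid hc_m_p hc_mid_p hc_mT_mid hc_mT_pT hc_mid_pT hmidD a
  have hfac1 : U * 1 * V = NormedSpace.exp (a • (QmT + Qmid + QpT)) * (Wp * 1 * Xp) *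
      NormedSpace.exp ((-a) • (Qm + Qmid + Qp)) :=
    exp_mul_mul_exp_neg_eq_conj hc_m_mid hc_m_p hc_mid_p hc_mT_mid hc_mT_pT hc_mid_pT hmid1 a
  -- isometries
  have hWp_iso : Wpᴴ * Wp = 1 := by
    have e : Wp = NormedSpace.exp ((I * ((-φ : ℝ) : ℂ)) • QpT) := by
      rw [hWp, ha]; push_cast; rw [mul_neg]
    rw [e]; exact conjTranspose_exp_I_mul_smul_mul_self hQpT (-φ)
  have hXp_iso : Xpᴴ * Xp = 1 := conjTranspose_exp_I_mul_smul_mul_self hQp φ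
  -- norms of the conjugated operators
  have hMD : ‖Wp * D * Xp‖ ≤ ‖D‖ := norm_isometry_mul_mul_isometry_le hWp_iso hXp_iso
  have hM1 : ‖Wp * 1 * Xp‖ ≤ 1 := by
    have h := norm_isometry_mul_mul_isometry_le (A := (1 : Matrix n n ℂ)) hWp_iso hXp_iso
    exact h.trans (norm_le_one_of_conjTranspose_mul_self (by rw [conjTranspose_one, Matrix.one_mul]))
  -- the symmetry tool, twice
  have hLD : ‖star ψ ⬝ᵥ ((U * D * V) *ᵥ ψ) - star ψ ⬝ᵥ ((Wp * D * Xp) *ᵥ ψ)‖ ≤ 2 * |φ| * ε * ‖D‖ := by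
    rw [hfacD]
    exact (norm_expect_exp_mul_mul_exp_neg_sub_expect_le hQbar hQbarT hψ1 hQ hQT φ).trans
      (mul_le_mul_of_nonneg_left hMD (by positivity))
  have hL1 : ‖star ψ ⬝ᵥ ((U * 1 * V) *ᵥ ψ) - star ψ ⬝ᵥ ((Wp * 1 * Xp) *ᵥ ψ)‖ ≤ 2 * |φ| * ε := by
    rw [hfac1]
    have h := norm_expect_exp_mul_mul_exp_neg_sub_expect_le (M := Wp * 1 * Xp) hQbar hQbarT hψ1 hQ hQT φ
    calc _ ≤ 2 * |φ| * ε * ‖Wp * 1 * Xp‖ := h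
      _ ≤ 2 * |φ| * ε * 1 := mul_le_mul_of_nonneg_left hM1 (by positivity)
      _ = 2 * |φ| * ε := mul_one _
  -- `Wp D Xp = D (Wp Xp)`
  have hWD : Wp * D * Xp = D * (Wp * Xp) :=
    exp_smul_mul_mul_of_commute (hc_mT_pT.symm.sub_right hc_m_pT.symm) (-a) Xp
  -- bookkeeping
  have hLD' : ‖star ψ ⬝ᵥ ((U * D * V) *ᵥ ψ) - star ψ ⬝ᵥ ((D * (Wp * Xp)) *ᵥ ψ)‖ ≤
      2 * |φ| * ε * ‖D‖ := by rw [← hWD]; exact hLD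
  have hL1' : ‖star ψ ⬝ᵥ ((U * V) *ᵥ ψ) - star ψ ⬝ᵥ ((Wp * Xp) *ᵥ ψ)‖ ≤ 2 * |φ| * ε := by
    have h := hL1
    rwa [Matrix.mul_one, Matrix.mul_one] at h
  have hd : ‖star ψ ⬝ᵥ (D *ᵥ ψ)‖ ≤ ‖D‖ := norm_expect_le_norm hψ1 D
  set LD := star ψ ⬝ᵥ ((U * D * V) *ᵥ ψ)
  set L1 := star ψ ⬝ᵥ ((U * V) *ᵥ ψ)
  set RD := star ψ ⬝ᵥ ((D * (Wp * Xp)) *ᵥ ψ)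
  set R1 := star ψ ⬝ᵥ ((Wp * Xp) *ᵥ ψ)
  set d := star ψ ⬝ᵥ (D *ᵥ ψ)
  have key : I * LD - I * d * L1 = I * ((LD - RD) + (RD - d * R1) + d * (R1 - L1)) := by ring
  rw [key, norm_mul, Complex.norm_I, one_mul]
  calc ‖(LD - RD) + (RD - d * R1) + d * (R1 - L1)‖
      ≤ ‖LD - RD‖ + ‖RD - d * R1‖ + ‖d * (R1 - L1)‖ := norm_add₃_le
    _ ≤ 2 * |φ| * ε * ‖D‖ + δ * ‖D‖ + ‖D‖ * (2 * |φ| * ε) := by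
        refine add_le_add (add_le_add hLD' hclD) ?_
        rw [norm_mul]
        refine mul_le_mul hd ?_ (norm_nonneg _) (norm_nonneg _)
        rw [norm_sub_rev]; exact hL1'
    _ = (4 * |φ| * ε + δ) * ‖D‖ := by ring

end OdeEstimate

/-! ### `χ(2π) = 1 + O(√ε, √δ)` (BBDF §4.4) -/

section TwoPi

omit [Fintype n] [DecidableEq n] in
/-- If `|c| = 1`, `|w| ≤ 1` and `|w - c| ≤ t` then `1 - |w|² ≤ 2t`. [folklore] -/
theorem one_sub_norm_sq_le_of_norm_sub_le {w c : ℂ} {t : ℝ} (hc : ‖c‖ = 1) (hw : ‖w‖ ≤ 1)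
    (h : ‖w - c‖ ≤ t) : 1 - ‖w‖ ^ 2 ≤ 2 * t := by
  have h1 : 1 - ‖w‖ ≤ t := by
    have h' := norm_sub_norm_le c w
    rw [hc, norm_sub_rev] at h'
    linarith
  nlinarith [norm_nonneg w, mul_le_mul_of_nonneg_left (show 1 + ‖w‖ ≤ 2 by linarith)
    (show (0 : ℝ) ≤ 1 - ‖w‖ by linarith)]

omit [DecidableEq n] in
/-- `⟨ψ, Vᴴ ψ⟩ = conj ⟨ψ, V ψ⟩`. [folklore] -/
theorem star_dotProduct_conjTranspose_mulVec (V : Matrix n n ℂ) (ψ : n → ℂ) :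
    star ψ ⬝ᵥ (Vᴴ *ᵥ ψ) = star (star ψ ⬝ᵥ (V *ᵥ ψ)) := by
  rw [← star_dotProduct_star, star_star, star_mulVec, dotProduct_mulVec]

/-- **BBDF §4.4 (exact-symmetry form): `χ(2π) = 1` up to `O(√ε + √δ)`.** Let `Tᴴ T = 1`,
`T ψ = λ ψ` for a unit vector `ψ` which is an `ε`-approximate eigenvector of
`Q̄ = Q̄₋ + Q_m + Q̄₊` (pairwise commuting Hermitian matrices) with `e^{2πiQ_m} = 1`, suppose the
support identity `Tᴴ e^{2πiQ̄₋} T = e^{2πiQ̄ᵀ₋}` and clustering between `R₋ = e^{2πiQ̄₋}` and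
`R₊ = e^{2πiQ̄₊}` up to `δ`. Then `Z₋(2π) = e^{2πiQ̄ᵀ₋} e^{-2πiQ̄₋} = Tᴴ R₋ T R₋ᴴ` and
`|⟨ψ, Z₋(2π) ψ⟩ - 1| ≤ 2√(4πε + 2δ) + (4πε + 2δ)`: `ψ` is an approximate eigenvector of
`e^{2πiQ̄} = R₋ R₊`, hence (BBDF Lemma 4.2) of `R₋` and of `R₋ᴴ`, and the four factors of `Z₋(2π)`
act on `ψ` by the scalars `λ⁻¹ ρ λ ρ̄ = |ρ|²`. [cite: BachmannEtAl2019, §4.4] -/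
theorem norm_chi_two_pi_sub_one_le {T Qm QmT Qp Qmid : Matrix n n ℂ} (hT : Tᴴ * T = 1)
    {ψ : n → ℂ} (hψ1 : star ψ ⬝ᵥ ψ = 1) {lam : ℂ} (hTψ : T *ᵥ ψ = lam • ψ)
    (hQm : Qm.IsHermitian) (hQp : Qp.IsHermitian) (hQmid : Qmid.IsHermitian)
    (hc_m_mid : Commute Qm Qmid) (hc_m_p : Commute Qm Qp) (hc_mid_p : Commute Qmid Qp)
    {q ε δ : ℝ} (hε : 0 ≤ ε) (hδ : 0 ≤ δ)
    (hQ : eucNorm ((Qm + Qmid + Qp) *ᵥ ψ - (q : ℂ) • ψ) ≤ ε)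
    (hmid : NormedSpace.exp ((2 * π * I) • Qmid) = 1)
    (hR4 : Tᴴ * NormedSpace.exp ((2 * π * I) • Qm) * T = NormedSpace.exp ((2 * π * I) • QmT))
    (hclR : ‖star ψ ⬝ᵥ ((NormedSpace.exp ((2 * π * I) • Qm) * NormedSpace.exp ((2 * π * I) • Qp)) *ᵥ ψ) -
        (star ψ ⬝ᵥ (NormedSpace.exp ((2 * π * I) • Qm) *ᵥ ψ)) *
          (star ψ ⬝ᵥ (NormedSpace.exp ((2 * π * I) • Qp) *ᵥ ψ))‖ ≤ δ) :
    ‖star ψ ⬝ᵥ ((NormedSpace.exp ((I * ((2 * π : ℝ) : ℂ)) • QmT) *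
        NormedSpace.exp ((-(I * ((2 * π : ℝ) : ℂ))) • Qm)) *ᵥ ψ) - 1‖ ≤
      2 * Real.sqrt (4 * π * ε + 2 * δ) + (4 * π * ε + 2 * δ) := by
  have h2π : (I * ((2 * π : ℝ) : ℂ)) = 2 * π * I := by push_cast; ring
  set Rm := NormedSpace.exp ((2 * π * I) • Qm) with hRm
  set Rp := NormedSpace.exp ((2 * π * I) • Qp) with hRp
  have hQbar : (Qm + Qmid + Qp).IsHermitian := (hQm.add hQmid).add hQp
  have hlam : ‖lam‖ = 1 := norm_eq_one_of_isometry_eigen hT hψ1 hTψ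
  have hlam0 : lam ≠ 0 := by
    intro h0; rw [h0, norm_zero] at hlam; exact zero_ne_one hlam
  have hTT : T * Tᴴ = 1 := mul_eq_one_comm.1 hT
  have hTH_iso : (Tᴴ)ᴴ * Tᴴ = 1 := by rw [conjTranspose_conjTranspose, hTT]
  have hTHψ : Tᴴ *ᵥ ψ = lam⁻¹ • ψ := conjTranspose_mulVec_of_isometry_eigen hT hTψ hlam0
  -- isometries
  have hRm_iso : Rmᴴ * Rm = 1 := by
    rw [hRm, ← h2π]; exact conjTranspose_exp_I_mul_smul_mul_self hQm _
  have hRm_iso' : Rm * Rmᴴ = 1 := by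
    rw [hRm, ← h2π]; exact exp_I_mul_smul_mul_conjTranspose_self hQm _
  have hRmH_iso : (Rmᴴ)ᴴ * Rmᴴ = 1 := by rw [conjTranspose_conjTranspose, hRm_iso']
  have hRp_iso : Rpᴴ * Rp = 1 := by
    rw [hRp, ← h2π]; exact conjTranspose_exp_I_mul_smul_mul_self hQp _
  have hRmH : Rmᴴ = NormedSpace.exp ((-(I * ((2 * π : ℝ) : ℂ))) • Qm) := by
    rw [hRm, ← h2π]; exact conjTranspose_exp_I_mul_smul hQm _
  -- `e^{2πiQ̄} = Rm Rp`
  have hW : NormedSpace.exp ((I * ((2 * π : ℝ) : ℂ)) • (Qm + Qmid + Qp)) = Rm * Rp := by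
    rw [h2π, exp_smul_add_add_of_commute hc_m_mid hc_m_p hc_mid_p, hmid, Matrix.mul_one]
  -- `ψ` is a `2πε`-approximate eigenvector of `Rm Rp`
  have hWψ : eucNorm ((Rm * Rp) *ᵥ ψ - cexp (I * (2 * π : ℝ) * q) • ψ) ≤ 2 * π * ε := by
    have h := eucNorm_exp_mulVec_sub_le hQbar ψ q (2 * π)
    rw [hW, abs_of_nonneg (by positivity)] at h
    exact h.trans (mul_le_mul_of_nonneg_left hQ (by positivity))
  have hW1 : 1 - ‖star ψ ⬝ᵥ ((Rm * Rp) *ᵥ ψ)‖ ^ 2 ≤ 2 * (2 * π * ε) := by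
    have hRmRp_iso : (Rm * Rp)ᴴ * (Rm * Rp) = 1 := by
      rw [conjTranspose_mul, Matrix.mul_assoc, ← Matrix.mul_assoc Rmᴴ, hRm_iso, Matrix.one_mul, hRp_iso]
    refine one_sub_norm_sq_le_of_norm_sub_le (c := cexp (I * (2 * π : ℝ) * q)) ?_
      (norm_expect_le_one_of_conjTranspose_mul_self hRmRp_iso hψ1)
      ((norm_expect_sub_le hψ1 _ _).trans hWψ)
    have e : (I * (2 * π : ℝ) * q : ℂ) = ((2 * π * q : ℝ) : ℂ) * I := by push_cast; ring
    rw [e, Complex.norm_exp_ofReal_mul_I]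
  -- BBDF Lemma 4.2: `1 - |ρ|² ≤ 4πε + 2δ`
  set ρ := star ψ ⬝ᵥ (Rm *ᵥ ψ) with hρ
  set η2 := 4 * π * ε + 2 * δ with hη2def
  have hη2 : 1 - ‖ρ‖ ^ 2 ≤ η2 := by
    have h := one_sub_norm_expect_sq_le hRm_iso hRp_iso hψ1 hclR
    rw [hη2def]; linarith
  have hη2_nonneg : 0 ≤ η2 := by positivity
  have hρ1 : ‖ρ‖ ≤ 1 := norm_expect_le_one_of_conjTranspose_mul_self hRm_iso hψ1
  -- approximate eigenvectors of `Rm` and `Rmᴴ`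
  set v₂ := Rm *ᵥ ψ - ρ • ψ with hv₂def
  have hv₂ : eucNorm v₂ ≤ Real.sqrt η2 := by
    have h := eucNorm_unitary_sub_expect_sq hRm_iso hψ1
    have h' : eucNorm v₂ ^ 2 ≤ η2 := by rw [hv₂def, hρ, h]; exact hη2
    have h'' := Real.abs_le_sqrt h'
    rwa [abs_of_nonneg (eucNorm_nonneg _)] at h''
  have hρ' : star ψ ⬝ᵥ (Rmᴴ *ᵥ ψ) = star ρ := star_dotProduct_conjTranspose_mulVec Rm ψ
  set v₁ := Rmᴴ *ᵥ ψ - (star ρ) • ψ with hv₁def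
  have hv₁ : eucNorm v₁ ≤ Real.sqrt η2 := by
    have h := eucNorm_unitary_sub_expect_sq hRmH_iso hψ1
    rw [hρ'] at h
    have h' : eucNorm v₁ ^ 2 ≤ η2 := by
      rw [hv₁def, h, norm_star]; exact hη2
    have h'' := Real.abs_le_sqrt h'
    rwa [abs_of_nonneg (eucNorm_nonneg _)] at h''
  -- `Z₋(2π) = Tᴴ Rm T Rmᴴ`
  have hZ : NormedSpace.exp ((I * ((2 * π : ℝ) : ℂ)) • QmT) * NormedSpace.exp ((-(I * ((2 * π : ℝ) : ℂ))) • Qm) =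
      Tᴴ * Rm * T * Rmᴴ := by
    rw [← hRmH, h2π, ← hR4]
  -- the action of the four factors on `ψ`
  have e1 : Rmᴴ *ᵥ ψ = (star ρ) • ψ + v₁ := by rw [hv₁def]; abel
  have e2 : Rm *ᵥ ψ = ρ • ψ + v₂ := by rw [hv₂def]; abel
  have hcoef : star ρ * lam * ρ * lam⁻¹ = ((‖ρ‖ ^ 2 : ℝ) : ℂ) := by
    rw [mul_assoc (star ρ) lam ρ, mul_comm lam ρ, ← mul_assoc, mul_assoc, mul_inv_cancel₀ hlam0, mul_one,
      Complex.star_def, Complex.conj_mul', Complex.ofReal_pow]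
  have hZψ : (Tᴴ * Rm * T * Rmᴴ) *ᵥ ψ - ((‖ρ‖ ^ 2 : ℝ) : ℂ) • ψ =
      (star ρ * lam) • (Tᴴ *ᵥ v₂) + Tᴴ *ᵥ (Rm *ᵥ (T *ᵥ v₁)) := by
    rw [← mulVec_mulVec, ← mulVec_mulVec, ← mulVec_mulVec, e1, mulVec_add, mulVec_smul, hTψ, smul_smul,
      mulVec_add, mulVec_smul, e2, smul_add, smul_smul, mulVec_add, mulVec_add, mulVec_smul, mulVec_smul,
      hTHψ, smul_smul, hcoef]
    abel
  have hZψ_le : eucNorm ((Tᴴ * Rm * T * Rmᴴ) *ᵥ ψ - ((‖ρ‖ ^ 2 : ℝ) : ℂ) • ψ) ≤ 2 * Real.sqrt η2 := by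
    rw [hZψ]
    calc eucNorm ((star ρ * lam) • (Tᴴ *ᵥ v₂) + Tᴴ *ᵥ (Rm *ᵥ (T *ᵥ v₁)))
        ≤ eucNorm ((star ρ * lam) • (Tᴴ *ᵥ v₂)) + eucNorm (Tᴴ *ᵥ (Rm *ᵥ (T *ᵥ v₁))) := eucNorm_add_le _ _
      _ = ‖star ρ‖ * eucNorm v₂ + eucNorm v₁ := by
          rw [eucNorm_smul, norm_mul, hlam, mul_one, eucNorm_mulVec_of_conjTranspose_mul_self hTH_iso,
            eucNorm_mulVec_of_conjTranspose_mul_self hTH_iso, eucNorm_mulVec_of_conjTranspose_mul_self hRm_iso,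
            eucNorm_mulVec_of_conjTranspose_mul_self hT]
      _ ≤ 1 * Real.sqrt η2 + Real.sqrt η2 := by
          refine add_le_add (mul_le_mul ?_ hv₂ (eucNorm_nonneg _) zero_le_one) hv₁
          rw [norm_star]; exact hρ1
      _ = 2 * Real.sqrt η2 := by ring
  -- conclusion
  rw [hZ]
  have h1 : ‖star ψ ⬝ᵥ ((Tᴴ * Rm * T * Rmᴴ) *ᵥ ψ) - ((‖ρ‖ ^ 2 : ℝ) : ℂ)‖ ≤ 2 * Real.sqrt η2 :=
    (norm_expect_sub_le hψ1 _ _).trans hZψ_le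
  have h2 : ‖(((‖ρ‖ ^ 2 : ℝ) : ℂ)) - 1‖ ≤ η2 := by
    rw [← Complex.ofReal_one, ← Complex.ofReal_sub, Complex.norm_real, Real.norm_eq_abs, abs_sub_comm,
      abs_of_nonneg (by nlinarith [norm_nonneg ρ])]
    exact hη2
  calc ‖star ψ ⬝ᵥ ((Tᴴ * Rm * T * Rmᴴ) *ᵥ ψ) - 1‖
      ≤ ‖star ψ ⬝ᵥ ((Tᴴ * Rm * T * Rmᴴ) *ᵥ ψ) - ((‖ρ‖ ^ 2 : ℝ) : ℂ)‖ + ‖(((‖ρ‖ ^ 2 : ℝ) : ℂ)) - 1‖ :=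
        norm_sub_le_norm_sub_add_norm_sub _ _ _
    _ ≤ 2 * Real.sqrt η2 + η2 := add_le_add h1 h2

end TwoPi

/-! ### The index theorem for an exact symmetry -/

section Main

/-- **The many-body index theorem for an exact symmetry (Bachmann–Bols–De Roeck–Fraas,
Theorem 2.1 with §4, in the case `UΩ = λΩ`).** Finite-dimensional, fully quantitative form.
Data: a unit vector `ψ`; an isometry `T` with `Tψ = λψ` (the symmetry, BBDF's `U`); two
elementwise commuting subalgebras `𝔄₋`, `𝔄₊` (observables near the two boundaries `∂₋`, `∂₊`)
between which the state `ψ` clusters up to `δ‖a‖‖b‖` (BBDF Assumption (v), as used); Hermitian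
`Q̄₋, Q̄ᵀ₋ ∈ 𝔄₋`, `Q̄₊, Q̄ᵀ₊ ∈ 𝔄₊` and `Q_m` commuting with `𝔄₋ ∪ 𝔄₊` (the three pieces of the
dressed half-space charge `Q̄ = Q̄₋ + Q_m + Q̄₊ = Q - K₋ - K₊` and of its translate
`Q̄ᵀ = Tᴴ Q̄ T = Q̄ᵀ₋ + Q_m + Q̄ᵀ₊`, BBDF eqs. (4.5)–(4.6) with `Q̄ᵁ = U⋆Q̄U` exactly), such that
`ψ` is an `ε`-approximate eigenvector of `Q̄` (Assumption (iv)), `e^{2πiQ_m} = 1` (integrality of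
the charge) and `Tᴴ e^{2πiQ̄₋} T = e^{2πiQ̄ᵀ₋}` (the support computation of BBDF §4.4, which in the
applications follows from local charge conservation (ii) and `e^{2πiQ_X} = 1`). Conclusion
(Theorem 2.1: `⟨Ω, T₋Ω⟩ ∈ ℤ + O(L^{-∞})`, here with `T₋ - (K₋ᵁ - K₋) = Q̄ᵀ₋ - Q̄₋ =: D`, whose
expectation equals `⟨T₋⟩` by the symmetry): the real number `⟨ψ, Dψ⟩` is within
`(2π(8πε + δ)‖D‖ + 2√(4πε + 2δ) + 4πε + 2δ)/4` of an integer. Proof (BBDF §4.3–4.4): the phase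
`χ(φ) = ⟨ψ, e^{iφQ̄ᵀ₋}e^{-iφQ̄₋}ψ⟩` satisfies `χ' = i⟨D⟩χ + O((ε+δ)‖D‖)` (`norm_chi_deriv_sub_le`),
hence `χ(2π) = e^{2πi⟨D⟩} + O(·)`, while `χ(2π) = 1 + O(√ε + √δ)` (`norm_chi_two_pi_sub_one_le`);
finally `dist(x, ℤ) ≤ |e^{2πix} - 1|/4`.
[cite: BachmannEtAl2019, Theorem 2.1 and §4 (Lemmas 4.4–4.6, §4.4), case of an exact symmetry] -/
theorem exists_int_abs_expect_sub_le_of_exact_symmetry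
    {ψ : n → ℂ} (hψ1 : star ψ ⬝ᵥ ψ = 1) {T : Matrix n n ℂ} (hT : Tᴴ * T = 1) {lam : ℂ}
    (hTψ : T *ᵥ ψ = lam • ψ)
    {Sm Sp : Subalgebra ℂ (Matrix n n ℂ)} (hSS : ∀ a ∈ Sm, ∀ b ∈ Sp, Commute a b)
    {δ : ℝ} (hδ : 0 ≤ δ)
    (hcl : ∀ a ∈ Sm, ∀ b ∈ Sp, ‖star ψ ⬝ᵥ ((a * b) *ᵥ ψ) -
      (star ψ ⬝ᵥ (a *ᵥ ψ)) * (star ψ ⬝ᵥ (b *ᵥ ψ))‖ ≤ δ * ‖a‖ * ‖b‖)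
    {Qm QmT Qp QpT Qmid : Matrix n n ℂ} (hQm : Qm.IsHermitian) (hQmT : QmT.IsHermitian)
    (hQp : Qp.IsHermitian) (hQpT : QpT.IsHermitian) (hQmid : Qmid.IsHermitian)
    (hQm_mem : Qm ∈ Sm) (hQmT_mem : QmT ∈ Sm) (hQp_mem : Qp ∈ Sp) (hQpT_mem : QpT ∈ Sp)
    (hmid_m : ∀ a ∈ Sm, Commute Qmid a) (hmid_p : ∀ b ∈ Sp, Commute Qmid b)
    {q ε : ℝ} (hε : 0 ≤ ε) (hQ : eucNorm ((Qm + Qmid + Qp) *ᵥ ψ - (q : ℂ) • ψ) ≤ ε)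
    (hQT : Tᴴ * (Qm + Qmid + Qp) * T = QmT + Qmid + QpT)
    (hmid : NormedSpace.exp ((2 * π * I) • Qmid) = 1)
    (hR4 : Tᴴ * NormedSpace.exp ((2 * π * I) • Qm) * T = NormedSpace.exp ((2 * π * I) • QmT)) :
    ∃ m : ℤ, |(star ψ ⬝ᵥ ((QmT - Qm) *ᵥ ψ)).re - m| ≤
      (2 * π * ((8 * π * ε + δ) * ‖QmT - Qm‖) +
        (2 * Real.sqrt (4 * π * ε + 2 * δ) + (4 * π * ε + 2 * δ))) / 4 := by
  -- the approximate eigenvector transported by the symmetry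
  have hQT' : eucNorm ((QmT + Qmid + QpT) *ᵥ ψ - (q : ℂ) • ψ) ≤ ε := by
    rw [← hQT, eucNorm_conjTranspose_mul_mul_mulVec_sub_smul hT hψ1 hTψ]; exact hQ
  -- commutation relations
  have hc_m_mid : Commute Qm Qmid := (hmid_m Qm hQm_mem).symm
  have hc_m_p : Commute Qm Qp := hSS Qm hQm_mem Qp hQp_mem
  have hc_mid_p : Commute Qmid Qp := hmid_p Qp hQp_mem
  have hc_mT_mid : Commute QmT Qmid := (hmid_m QmT hQmT_mem).symm
  have hc_mT_pT : Commute QmT QpT := hSS QmT hQmT_mem QpT hQpT_mem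
  have hc_mid_pT : Commute Qmid QpT := hmid_p QpT hQpT_mem
  have hc_m_pT : Commute Qm QpT := hSS Qm hQm_mem QpT hQpT_mem
  set D := QmT - Qm with hDdef
  have hD_mem : D ∈ Sm := Sm.sub_mem hQmT_mem hQm_mem
  have hDh : D.IsHermitian := hQmT.sub hQm
  -- the index `a = ⟨ψ, Dψ⟩ ∈ ℝ`
  set a : ℝ := (star ψ ⬝ᵥ (D *ᵥ ψ)).re with hadef
  have ha : star ψ ⬝ᵥ (D *ᵥ ψ) = (a : ℂ) := expect_eq_re_of_isHermitian hDh ψ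
  -- the phase `χ` and its derivative
  set χ : ℝ → ℂ := fun u => star ψ ⬝ᵥ ((NormedSpace.exp ((I * (u : ℂ)) • QmT) *
    NormedSpace.exp ((-(I * (u : ℂ))) • Qm)) *ᵥ ψ) with hχdef
  set χ' : ℝ → ℂ := fun u => I * (star ψ ⬝ᵥ ((NormedSpace.exp ((I * (u : ℂ)) • QmT) * D *
    NormedSpace.exp ((-(I * (u : ℂ))) • Qm)) *ᵥ ψ)) with hχ'def
  have hderiv : ∀ s ∈ Set.Icc (0 : ℝ) (2 * π), HasDerivAt χ (χ' s) s := fun s _ =>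
    hasDerivAt_expect_exp_mul_exp_neg QmT Qm ψ s
  -- the differential inequality on `[0, 2π]`
  have hE : ∀ s ∈ Set.Icc (0 : ℝ) (2 * π), ‖χ' s - I * a * χ s‖ ≤ (8 * π * ε + δ) * ‖D‖ := by
    intro s hs
    -- clustering between `D ∈ 𝔄₋` and `Z₊(-s) ∈ 𝔄₊`
    set b := NormedSpace.exp ((-(I * (s : ℂ))) • QpT) * NormedSpace.exp ((I * (s : ℂ)) • Qp) with hbdef
    have hb_mem : b ∈ Sp :=
      Sp.mul_mem (exp_mem_of_mem_subalgebra Sp (Sp.smul_mem hQpT_mem _))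
        (exp_mem_of_mem_subalgebra Sp (Sp.smul_mem hQp_mem _))
    have hb_iso : bᴴ * b = 1 := by
      have h1 : (NormedSpace.exp ((-(I * (s : ℂ))) • QpT))ᴴ * NormedSpace.exp ((-(I * (s : ℂ))) • QpT) = 1 := by
        have e : (-(I * (s : ℂ))) = I * ((-s : ℝ) : ℂ) := by push_cast; ring
        rw [e]; exact conjTranspose_exp_I_mul_smul_mul_self hQpT (-s)
      have h2 := conjTranspose_exp_I_mul_smul_mul_self hQp s
      rw [hbdef, conjTranspose_mul, Matrix.mul_assoc, ← Matrix.mul_assoc _ᴴ (NormedSpace.exp _),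
        h1, Matrix.one_mul, h2]
    have hb_norm : ‖b‖ ≤ 1 := norm_le_one_of_conjTranspose_mul_self hb_iso
    have hclD : ‖star ψ ⬝ᵥ ((D * b) *ᵥ ψ) - (star ψ ⬝ᵥ (D *ᵥ ψ)) * (star ψ ⬝ᵥ (b *ᵥ ψ))‖ ≤ δ * ‖D‖ := by
      refine (hcl D hD_mem b hb_mem).trans ?_
      calc δ * ‖D‖ * ‖b‖ ≤ δ * ‖D‖ * 1 := mul_le_mul_of_nonneg_left hb_norm (by positivity)
        _ = δ * ‖D‖ := mul_one _
    have h := norm_chi_deriv_sub_le hQm hQmT hQp hQpT hQmid hc_m_mid hc_m_p hc_mid_p hc_mT_mid hc_mT_pT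
      hc_mid_pT hc_m_pT hψ1 hε hQ hQT' s hclD
    have hs2π : |s| ≤ 2 * π := by rw [abs_of_nonneg hs.1]; exact hs.2
    have hχs : χ' s - I * a * χ s = I * (star ψ ⬝ᵥ ((NormedSpace.exp ((I * (s : ℂ)) • QmT) * D *
        NormedSpace.exp ((-(I * (s : ℂ))) • Qm)) *ᵥ ψ)) -
          I * (star ψ ⬝ᵥ (D *ᵥ ψ)) * (star ψ ⬝ᵥ ((NormedSpace.exp ((I * (s : ℂ)) • QmT) *
            NormedSpace.exp ((-(I * (s : ℂ))) • Qm)) *ᵥ ψ)) := by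
      rw [hχ'def, hχdef, ha]
    rw [hχs]
    refine h.trans ?_
    have hDn := norm_nonneg D
    nlinarith [mul_le_mul_of_nonneg_right hs2π (by positivity : (0 : ℝ) ≤ 4 * ε * ‖D‖)]
  -- integrate: `χ(2π) = e^{2πia} χ(0) + O(·)`
  have hint := norm_sub_cexp_mul_le_of_hasDerivAt (by positivity : (0 : ℝ) ≤ 2 * π) hderiv hE
  have hχ0 : χ 0 = 1 := by
    simp only [hχdef, Complex.ofReal_zero, mul_zero, neg_zero, zero_smul, NormedSpace.exp_zero,
      Matrix.mul_one, one_mulVec]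
    exact hψ1
  rw [hχ0, mul_one] at hint
  -- `χ(2π) = 1 + O(·)`
  set Rm := NormedSpace.exp ((2 * π * I) • Qm) with hRm
  set Rp := NormedSpace.exp ((2 * π * I) • Qp) with hRp
  have h2π : (I * ((2 * π : ℝ) : ℂ)) = 2 * π * I := by push_cast; ring
  have hRm_mem : Rm ∈ Sm := exp_mem_of_mem_subalgebra Sm (Sm.smul_mem hQm_mem _)
  have hRp_mem : Rp ∈ Sp := exp_mem_of_mem_subalgebra Sp (Sp.smul_mem hQp_mem _)
  have hRm_norm : ‖Rm‖ ≤ 1 := by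
    refine norm_le_one_of_conjTranspose_mul_self ?_
    rw [hRm, ← h2π]; exact conjTranspose_exp_I_mul_smul_mul_self hQm _
  have hRp_norm : ‖Rp‖ ≤ 1 := by
    refine norm_le_one_of_conjTranspose_mul_self ?_
    rw [hRp, ← h2π]; exact conjTranspose_exp_I_mul_smul_mul_self hQp _
  have hclR : ‖star ψ ⬝ᵥ ((Rm * Rp) *ᵥ ψ) - (star ψ ⬝ᵥ (Rm *ᵥ ψ)) * (star ψ ⬝ᵥ (Rp *ᵥ ψ))‖ ≤ δ := by
    refine (hcl Rm hRm_mem Rp hRp_mem).trans ?_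
    calc δ * ‖Rm‖ * ‖Rp‖ ≤ δ * 1 * 1 := by gcongr
      _ = δ := by ring
  have h44 := norm_chi_two_pi_sub_one_le hT hψ1 hTψ hQm hQp hQmid hc_m_mid hc_m_p hc_mid_p hε hδ hQ hmid
    hR4 hclR
  -- `|e^{2πia} - 1| ≤ …`
  have hχ2π : χ (2 * π) = star ψ ⬝ᵥ ((NormedSpace.exp ((I * ((2 * π : ℝ) : ℂ)) • QmT) *
      NormedSpace.exp ((-(I * ((2 * π : ℝ) : ℂ))) • Qm)) *ᵥ ψ) := rfl
  have hexp : ‖cexp (2 * π * I * a) - 1‖ ≤ (8 * π * ε + δ) * ‖D‖ * (2 * π) +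
      (2 * Real.sqrt (4 * π * ε + 2 * δ) + (4 * π * ε + 2 * δ)) := by
    have e : cexp (2 * π * I * a) = cexp (I * a * ((2 * π : ℝ) : ℂ)) := by
      congr 1; push_cast; ring
    rw [e]
    calc ‖cexp (I * a * ((2 * π : ℝ) : ℂ)) - 1‖
        ≤ ‖cexp (I * a * ((2 * π : ℝ) : ℂ)) - χ (2 * π)‖ + ‖χ (2 * π) - 1‖ := norm_sub_le_norm_sub_add_norm_sub _ _ _
      _ ≤ (8 * π * ε + δ) * ‖D‖ * (2 * π) + (2 * Real.sqrt (4 * π * ε + 2 * δ) + (4 * π * ε + 2 * δ)) := by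
          refine add_le_add ?_ ?_
          · rw [norm_sub_rev]; exact hint
          · rw [hχ2π]; exact h44
  obtain ⟨m, hm⟩ := exists_int_abs_sub_le_norm_cexp_sub_one a
  refine ⟨m, hm.trans ?_⟩
  have h4 : (0 : ℝ) < 4 := by norm_num
  rw [div_le_div_iff_of_pos_right h4]
  linarith

end Main

end Literature.MathematicalPhysics.QuantumLattice

end
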